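import Literature.NumberTheory.EllipticCurves.FineSelmerClassGroupCriterion
import HarnessLib

/-!
# The unipotent stabiliser `U_P` of a torsion point and its fixed field `ℚ(P, μ_p) ⊆ ℚ(E[p])`:
# the smallest subfield of the division field to which Lim's `L`-form of the class-group road applies

Topic `NumberTheory/EllipticCurves` (namespace `WeierstrassCurve` for the two definitions, dot-notation on the
curve; `Literature.NumberTheory.EllipticCurves.Lim2017` for the doors).  Written by the literature seat
`bsd-potss-conjA-anchor` g9 (cell `bsd-potss`, rungs K9/KT of `BirchSwinnertonDyer`; `--supports`
stmt-BirchSwinnertonDyer-19386 / 19942; closes nothing; BSD is proved for no curve here).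

## Why

The class-group road (b) to Coates–Sujatha's statement (A) for `E/ℚ` at an odd prime `p` — «Iwasawa's classical
`μ = 0` for the cyclotomic `ℤ_p`-tower of `L` ⇒ (A)» — is in the tree for `L = ℚ(E[p])` (Coates–Sujatha 2005
Thm. 3.4, fact `CoatesSujatha2005.thm34_…`) and, more generally, for every subfield `L ⊆ ℚ(E[p])` with
`[ℚ(E[p]) : L]` a power of `p` (Lim 2017 Thm. 3.5 + Lemma 3.2, fact
`Lim2017.thm35_fineSelmerDual_moduleFinite_of_classicalMuVanishes_of_le_divisionField`).  The input `μ = 0` is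
supplied per curve by class-group NUMERICS of `L` (Iwasawa 1956: `p ∤ h(L)` and one prime of `L` above `p`;
Fukuda 1994 Thm. 1), so the smaller `L`, the better.  Since `p ∥ #GL₂(𝔽_p)`, a Sylow `p`-subgroup of
`G = Gal(ℚ(E[p])/ℚ) ≤ GL₂(𝔽_p)` has order `1` or `p`; the smallest admissible `L` is its fixed field.  A Sylow
`p`-subgroup containing a given transvection is the UNIPOTENT STABILISER of a non-zero point `P`,
`U_P = {σ ∈ Γ_ℚ : σP = P and σQ − Q ∈ ℤP for all Q ∈ E[p]}` (the matrices `(1 *; 0 1)` in a basis `(P, Q)`);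
this file defines `U_P` for any field `K`, any `n`, any `P ∈ E[n]` (`WeierstrassCurve.unipotentStabilizer`), proves
that its image in `Gal(K(E[p])/K)` is a `p`-GROUP for a prime `p` (every element has order dividing `p`:
`σ^p Q = Q + p(σQ − Q) = Q`), hence that its fixed field `K(E[p])^{U_P}` (`WeierstrassCurve.unipotentStabilizerField`,
an intermediate field of `K̄/K` below `K(E[p])`) satisfies Lim's index hypothesis
`[K(E[p]) : K] = p^k · [K(E[p])^{U_P} : K]`, `k ≤ 1` — for EVERY elliptic `E`, prime `p` and `P` (also `P = 0`,
where `U_P` is the kernel and the field is `K(E[p])`).  By the Weil pairing `K(E[p])^{U_P} = K(P, μ_p)` for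
`P ≠ 0` (folklore; Serre 1972 §IV; NOT proved here — the census identifies the field on the certificate side, as
the cell's records do for `ℚ(P)`): `-- TODO(identification): fixedField U_P = K⟮x(P), y(P), ζ_p⟯ via the Weil pairing.`
On the cell's census at `p = 3`: on Cartan-image rows (`3 ∤ #G`) the field is `ℚ(E[3])` itself (degree `8`/`16`),
on the `GL₂(𝔽₃)`-image rows (`#G = 48`, the `9`-deficient «Elkies» rows of `stub_fineA_wild_surjModThree`) it has
degree `16` instead of `48` — the only rows on which no `μ`-road could be run before.

## Main results (sorry-free; no new `def … : Prop`)

* `WeierstrassCurve.unipotentStabilizer`, `mem_unipotentStabilizer_iff`, `pow_smul_eq_add_nsmul_of_mem_unipotentStabilizer`,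
  `pow_smul_eq_self_of_mem_unipotentStabilizer` (`σ^m` acts trivially on `E[m]`);
* `isPGroup_map_unipotentStabilizer` (the image in `Gal(K(E[p])/K)` is a `p`-group),
  `WeierstrassCurve.unipotentStabilizerField`, `unipotentStabilizerField_le_divisionField`,
  `exists_finrank_divisionField_eq_pow_mul_finrank_unipotentStabilizerField` (Lim's index hypothesis, structurally);
* the doors BY NAME on that field (`Lim2017.fineSelmerDual_moduleFinite_of_…_unipotentStabilizerField…`): statement (A)
  for `W` at `p` from the named facts {Lim 2017 Thm. 3.5, Iwasawa 1956 | Fukuda 1994 Thm. 1 (1) | (2)} and the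
  displayed NUMERIC hypotheses on `ℚ(E[p])^{U_P}` only.  CONDITIONAL on the facts; (A) is asserted for no curve.

## References

* M. F. Lim, *Notes on the fine Selmer groups*, Asian J. Math. 21 (2017) 337–362, §3 Thm. 3.5, Lemma 3.2, Remark (a)
  (arXiv:1306.2047 pp. 6–7). [Lim2017FineSelmer]
* J.-P. Serre, *Propriétés galoisiennes des points d'ordre fini des courbes elliptiques*, Invent. Math. 15 (1972),
  §IV (subgroups of `GL₂(𝔽_p)`; `p ∥ #GL₂(𝔽_p)`). [Serre1972]
* R. Greenberg, *Iwasawa theory — past and present* (2001), Prop. 2.1 p. 339 (Iwasawa 1956). [Greenberg2001IwasawaPastPresent]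
* T. Fukuda, Proc. Japan Acad. 70 (1994), Thm. 1 p. 264. [Fukuda1994]
-/

noncomputable section

open scoped Classical

universe u

namespace WeierstrassCurve

open Field Literature.NumberTheory.EllipticCurves Literature.NumberTheory.GaloisRepresentations

variable {K : Type u} [Field K] (W : WeierstrassCurve K)

/-! ## §1 The unipotent stabiliser of a torsion point -/

section Unipotent

variable {n : ℤ}

/-- **The unipotent stabiliser `U_P ≤ Γ_K` of an `n`-torsion point `P ∈ E[n]`**: the `σ ∈ Γ_K` with `σP = P`
that act trivially on `E[n]/ℤP`, i.e. `σQ − Q ∈ ℤP` for every `Q ∈ E[n]` — in a basis `(P, Q)` of `E[p] ≅ 𝔽_p²`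
(`p` prime, `P ≠ 0`) the preimage of the unipotent matrices `(1 *; 0 1)`, a Sylow `p`-subgroup of the image
when `p` divides its order.  A DEFINITION (a subgroup of `Γ_K` attached to `(E, n, P)`).
[cite: Serre1972, §IV (the p-subgroups of GL₂(𝔽_p))] -/
def unipotentStabilizer (P : geomTorsion W n) : Subgroup (absoluteGaloisGroup K) where
  carrier := {σ | σ • P = P ∧ ∀ Q : geomTorsion W n, σ • Q - Q ∈ AddSubgroup.zmultiples P}
  one_mem' := ⟨one_smul _ _, fun Q => by simp only [one_smul, sub_self, zero_mem]⟩
  mul_mem' := by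
    rintro σ τ ⟨hσP, hσ⟩ ⟨hτP, hτ⟩
    refine ⟨by rw [mul_smul, hτP, hσP], fun Q => ?_⟩
    obtain ⟨a, ha⟩ := AddSubgroup.mem_zmultiples_iff.mp (hτ Q)
    have hτQ : τ • Q = Q + a • P := by rw [ha]; abel
    have hσaP : σ • (a • P) = a • P := by
      rw [show σ • (a • P) = a • (σ • P) from map_zsmul (DistribSMul.toAddMonoidHom _ σ) a P, hσP]
    rw [mul_smul, hτQ, smul_add, hσaP, show σ • Q + a • P - Q = (σ • Q - Q) + a • P by abel]
    exact add_mem (hσ Q) ⟨a, rfl⟩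
  inv_mem' := by
    rintro σ ⟨hσP, hσ⟩
    refine ⟨by rw [inv_smul_eq_iff, hσP], fun Q => ?_⟩
    have h := hσ (σ⁻¹ • Q)
    rw [smul_inv_smul] at h
    have h' := neg_mem h
    rwa [neg_sub] at h'

/-- Unfolding lemma for `unipotentStabilizer`. [cite: Serre1972, §IV] -/
theorem mem_unipotentStabilizer_iff {P : geomTorsion W n} {σ : absoluteGaloisGroup K} :
    σ ∈ W.unipotentStabilizer P ↔ σ • P = P ∧ ∀ Q : geomTorsion W n, σ • Q - Q ∈ AddSubgroup.zmultiples P :=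
  Iff.rfl

/-- The kernel of the mod-`n` representation lies in every unipotent stabiliser. [cite: Serre1972, §IV (p-subgroups of GL₂(𝔽_p))] -/
theorem mem_unipotentStabilizer_of_forall_smul_eq {P : geomTorsion W n} {σ : absoluteGaloisGroup K}
    (h : ∀ Q : geomTorsion W n, σ • Q = Q) : σ ∈ W.unipotentStabilizer P :=
  ⟨h P, fun Q => by rw [h Q, sub_self]; exact zero_mem _⟩

/-- An element of `U_P` fixes every multiple of `P`, in particular `σQ − Q`. [cite: Serre1972, §IV (p-subgroups of GL₂(𝔽_p))] -/
theorem smul_eq_self_of_mem_unipotentStabilizer_of_mem_zmultiples {P : geomTorsion W n}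
    {σ : absoluteGaloisGroup K} (hσ : σ ∈ W.unipotentStabilizer P) {D : geomTorsion W n}
    (hD : D ∈ AddSubgroup.zmultiples P) : σ • D = D := by
  obtain ⟨a, rfl⟩ := AddSubgroup.mem_zmultiples_iff.mp hD
  rw [show σ • (a • P) = a • (σ • P) from map_zsmul (DistribSMul.toAddMonoidHom _ σ) a P, hσ.1]

/-- **`σ^j Q = Q + j·(σQ − Q)` for `σ ∈ U_P`** (the unipotent matrix `(1 b; 0 1)` has `j`-th power `(1 jb; 0 1)`).
[cite: Serre1972, §IV] -/
theorem pow_smul_eq_add_nsmul_of_mem_unipotentStabilizer {P : geomTorsion W n} {σ : absoluteGaloisGroup K}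
    (hσ : σ ∈ W.unipotentStabilizer P) (Q : geomTorsion W n) (j : ℕ) :
    (σ ^ j) • Q = Q + j • (σ • Q - Q) := by
  induction j with
  | zero => rw [pow_zero, one_smul, zero_nsmul, add_zero]
  | succ j ih =>
    have hD : σ • (σ • Q - Q) = σ • Q - Q :=
      W.smul_eq_self_of_mem_unipotentStabilizer_of_mem_zmultiples hσ (hσ.2 Q)
    have hj : σ • (j • (σ • Q - Q)) = j • (σ • Q - Q) := by
      rw [show σ • (j • (σ • Q - Q)) = j • (σ • (σ • Q - Q)) from
        map_nsmul (DistribSMul.toAddMonoidHom _ σ) j (σ • Q - Q), hD]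
    rw [pow_succ', mul_smul, ih, smul_add, hj, succ_nsmul]
    abel

/-- **`σ^m` acts trivially on `E[m]` for `σ ∈ U_P`** (`m : ℕ`): the image of `U_P` in `Aut(E[m])` has
exponent dividing `m` (`σ^m Q = Q + m·(σQ − Q)` and `E[m]` is killed by `m`). [cite: Serre1972, §IV] -/
theorem pow_smul_eq_self_of_mem_unipotentStabilizer {m : ℕ} {P : geomTorsion W m}
    {σ : absoluteGaloisGroup K} (hσ : σ ∈ W.unipotentStabilizer P) (Q : geomTorsion W m) :
    (σ ^ m) • Q = Q := by
  rw [W.pow_smul_eq_add_nsmul_of_mem_unipotentStabilizer hσ Q m, AddSubgroup.torsionBy.nsmul, add_zero]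

end Unipotent

/-! ## §2 The image in `Gal(K(E[p])/K)` is a `p`-group; the fixed field and Lim's index hypothesis -/

section Galois

variable [CharZero K]

/-- **The image of `U_P` in `Gal(K(E[p])/K)` is a `p`-group** (`E` elliptic, `p` prime): every element `g = σ|`
satisfies `g^p = (σ^p)| = 1` because `σ^p` fixes `E[p]` pointwise (`pow_smul_eq_self_of_mem_unipotentStabilizer` +
`absRestrictNormalHom_divisionField_eq_one_iff`). [cite: Serre1972, §IV] -/
theorem isPGroup_map_unipotentStabilizer [W.IsElliptic] (p : ℕ) [Fact p.Prime] (P : geomTorsion W p) :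
    haveI : NeZero p := ⟨(Fact.out : p.Prime).ne_zero⟩
    IsPGroup p ((W.unipotentStabilizer P).map (absRestrictNormalHom (W.divisionField p))) := by
  haveI : NeZero p := ⟨(Fact.out : p.Prime).ne_zero⟩
  intro g
  refine ⟨1, ?_⟩
  obtain ⟨σ, hσ, hσg⟩ := Subgroup.mem_map.mp g.2
  apply Subtype.ext
  rw [pow_one, SubmonoidClass.coe_pow, OneMemClass.coe_one, ← hσg, ← map_pow,
    W.absRestrictNormalHom_divisionField_eq_one_iff p]
  intro T
  exact W.pow_smul_eq_self_of_mem_unipotentStabilizer hσ T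

/-- **The fixed field `K(E[p])^{U_P}` as an intermediate field of `K̄/K`** (lifted from `K(E[p])`): for `P ≠ 0` this is
`K(P, μ_p)` by the Weil pairing (folklore; identification not proved here), for `P = 0` it is `K(E[p])`.  A
DEFINITION. [cite: Lim2017FineSelmer, §3 Thm. 3.5 (the field L)] [cite: Serre1972, §IV] -/
def unipotentStabilizerField [W.IsElliptic] (p : ℕ) [NeZero p] (P : geomTorsion W p) :
    IntermediateField K (AlgebraicClosure K) :=
  IntermediateField.lift
    (IntermediateField.fixedField ((W.unipotentStabilizer P).map (absRestrictNormalHom (W.divisionField p))))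

/-- Unfolding lemma for `unipotentStabilizerField`. [cite: Lim2017FineSelmer, §3 Thm. 3.5 (the field L)] -/
theorem unipotentStabilizerField_def [W.IsElliptic] (p : ℕ) [NeZero p] (P : geomTorsion W p) :
    W.unipotentStabilizerField p P = IntermediateField.lift (IntermediateField.fixedField
      ((W.unipotentStabilizer P).map (absRestrictNormalHom (W.divisionField p)))) :=
  rfl

/-- `K(E[p])^{U_P} ⊆ K(E[p])` (Lim's hypothesis «`L` a subfield of `F(E[p])`»). [cite: Lim2017FineSelmer, §3 Thm. 3.5 (the field L)] -/
theorem unipotentStabilizerField_le_divisionField [W.IsElliptic] (p : ℕ) [NeZero p] (P : geomTorsion W p) :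
    W.unipotentStabilizerField p P ≤ W.divisionField p := by
  rw [unipotentStabilizerField_def]
  exact IntermediateField.lift_le _

/-- **Lim's index hypothesis holds structurally for `K(E[p])^{U_P}`**: `[K(E[p]) : K] = p^k · [K(E[p])^{U_P} : K]`
for some `k` (indeed `k ≤ 1`: the image of `U_P` is a `p`-group inside `GL₂(𝔽_p)`, and `p ∥ #GL₂(𝔽_p)`; only the
`p`-power is recorded). [cite: Lim2017FineSelmer, §3 Thm. 3.5 (hypothesis on L)] [cite: Serre1972, §IV] -/
theorem exists_finrank_divisionField_eq_pow_mul_finrank_unipotentStabilizerField [W.IsElliptic] (p : ℕ)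
    [Fact p.Prime] (P : geomTorsion W p) :
    haveI : NeZero p := ⟨(Fact.out : p.Prime).ne_zero⟩
    ∃ k : ℕ, Module.finrank K (W.divisionField p) =
      p ^ k * Module.finrank K (W.unipotentStabilizerField p P) := by
  haveI : NeZero p := ⟨(Fact.out : p.Prime).ne_zero⟩
  set H := (W.unipotentStabilizer P).map (absRestrictNormalHom (W.divisionField p)) with hH
  obtain ⟨k, hk⟩ := IsPGroup.iff_card.mp (W.isPGroup_map_unipotentStabilizer p P)
  refine ⟨k, ?_⟩
  have htower := Module.finrank_mul_finrank K (IntermediateField.fixedField H) (W.divisionField p)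
  rw [IntermediateField.finrank_fixedField_eq_card H, hk] at htower
  have hlift : Module.finrank K (W.unipotentStabilizerField p P) =
      Module.finrank K (IntermediateField.fixedField H) :=
    (IntermediateField.liftAlgEquiv (IntermediateField.fixedField H)).toLinearEquiv.finrank_eq.symm
  rw [hlift, ← htower, mul_comm]

end Galois

end WeierstrassCurve

/-! ## §3 The doors on `ℚ(E[p])^{U_P}`, by name (Lim 2017 Thm. 3.5 ∘ Iwasawa 1956 / Fukuda 1994 Thm. 1) -/

namespace Literature.NumberTheory.EllipticCurves.Lim2017

open WeierstrassCurve Literature.NumberTheory.IwasawaTheory IsDedekindDomain NumberField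
open Literature.NumberTheory.GaloisRepresentations

/-- A subfield of the (finite) division field is finite over `ℚ` (bookkeeping). [folklore] -/
private theorem finiteDimensional_of_le_divisionField' (W : WeierstrassCurve ℚ) [W.IsElliptic] (p : ℕ)
    [NeZero p] {L : IntermediateField ℚ (AlgebraicClosure ℚ)} (hL : L ≤ W.divisionField p) :
    FiniteDimensional ℚ L :=
  FiniteDimensional.of_injective (IntermediateField.inclusion hL).toLinearMap
    (IntermediateField.inclusion_injective hL)

/-- **Door (Iwasawa 1956 ∘ Lim 2017 Thm. 3.5) on `L_P = ℚ(E[p])^{U_P}`, by name.**  Granted the named facts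
`iwasawa1956_classNumberPExp_eq_zero_of_not_dvd_classNumber_of_unique_prime` (`hIw`) and Lim's `L`-form (`hLim`):
for `p ≠ 2` and ANY `P ∈ W[p]`, if `p ∤ h(L_P)` and exactly one prime of `L_P` lies above `p`, then statement (A)
holds for `W` at `p`.  The index hypothesis of Lim's theorem is discharged structurally
(`exists_finrank_divisionField_eq_pow_mul_finrank_unipotentStabilizerField`); displayed: a class number and a prime
decomposition of `L_P` (`= ℚ(P, μ_p)` for `P ≠ 0`; `[L_P : ℚ] = #Gal(ℚ(W[p])/ℚ)/p` when `p ∣ #Gal`).  CONDITIONAL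
on the two facts; (A) is not asserted unconditionally.
[cite: Lim2017FineSelmer, §3 Thm. 3.5 and Lemma 3.2 (arXiv:1306.2047 pp. 6–7)]
[cite: Greenberg2001IwasawaPastPresent, Prop. 2.1 p. 339] -/
theorem fineSelmerDual_moduleFinite_of_not_dvd_card_classGroup_unipotentStabilizerField_of_unique_prime
    (hIw : iwasawa1956_classNumberPExp_eq_zero_of_not_dvd_classNumber_of_unique_prime)
    (hLim : thm35_fineSelmerDual_moduleFinite_of_classicalMuVanishes_of_le_divisionField)
    (W : WeierstrassCurve ℚ) [W.IsElliptic] (p : ℕ) [Fact p.Prime] (hp : p ≠ 2) (P : geomTorsion W p)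
    (hh : haveI : NeZero p := ⟨(Fact.out : p.Prime).ne_zero⟩
      ¬ p ∣ Nat.card (ClassGroup (𝓞 (W.unipotentStabilizerField p P))))
    (hv : haveI : NeZero p := ⟨(Fact.out : p.Prime).ne_zero⟩
      ∃! v : HeightOneSpectrum (𝓞 (W.unipotentStabilizerField p P)),
        ((p : ℕ) : 𝓞 (W.unipotentStabilizerField p P)) ∈ v.asIdeal)
    (κ : ZpExtension ℚ p) (hκ : κ.IsCyclotomic) :
    ∃ (γ : Field.absoluteGaloisGroup ℚ) (D : W.FineSelmerDualData κ γ),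
      Module.Finite ℤ_[p] (RestrictScalars ℤ_[p] (IwasawaAlgebra p) D.X) := by
  haveI : NeZero p := ⟨(Fact.out : p.Prime).ne_zero⟩
  have hL := W.unipotentStabilizerField_le_divisionField p P
  haveI : FiniteDimensional ℚ (W.unipotentStabilizerField p P) := finiteDimensional_of_le_divisionField' W p hL
  haveI : NumberField (W.unipotentStabilizerField p P) := NumberField.mk
  refine hLim W p hp _ hL (W.exists_finrank_divisionField_eq_pow_mul_finrank_unipotentStabilizerField p P)
    ?_ κ hκ
  intro κL _hκL
  have hh' : ¬ p ∣ NumberField.classNumber (W.unipotentStabilizerField p P) := by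
    rwa [NumberField.classNumber, ← Nat.card_eq_fintype_card]
  exact classicalMuVanishes_of_classNumberPExp_eq_zero hIw hh' hv κL

/-- **Door (Fukuda 1994 Thm. 1 (1) ∘ Lim 2017 Thm. 3.5) on `L_P = ℚ(E[p])^{U_P}`, by name, at any layer `n`.**
Granted Fukuda's Thm. 1 (1) (`hF1`) and Lim's `L`-form (`hLim`): for `p ≠ 2` and any `P ∈ W[p]`, if every
cyclotomic `ℤ_p`-extension `κ_L` of `L_P` has Fukuda's index `n₀ = 0` (`TotallyRamifiedFrom κ_L 0`) and
`ord_p h(L_{P,n+1}) = ord_p h(L_{P,n})` for ONE `n`, then statement (A) holds for `W` at `p`.  CONDITIONAL on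
the two facts; (A) not asserted.
[cite: Lim2017FineSelmer, §3 Thm. 3.5 and Lemma 3.2 (arXiv:1306.2047 pp. 6–7)] [cite: Fukuda1994, Thm. 1 (1), p. 264] -/
theorem fineSelmerDual_moduleFinite_of_classNumberPExp_succ_eq_unipotentStabilizerField
    (hF1 : fukuda1994_thm1_classNumberPExp_const_of_succ_eq)
    (hLim : thm35_fineSelmerDual_moduleFinite_of_classicalMuVanishes_of_le_divisionField)
    (W : WeierstrassCurve ℚ) [W.IsElliptic] (p : ℕ) [Fact p.Prime] (hp : p ≠ 2) (n : ℕ) (P : geomTorsion W p)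
    (hram : haveI : NeZero p := ⟨(Fact.out : p.Prime).ne_zero⟩
      ∀ κL : ZpExtension (W.unipotentStabilizerField p P) p, κL.IsCyclotomic → TotallyRamifiedFrom κL 0)
    (hord : haveI : NeZero p := ⟨(Fact.out : p.Prime).ne_zero⟩
      ∀ κL : ZpExtension (W.unipotentStabilizerField p P) p, κL.IsCyclotomic →
        classNumberPExp κL (n + 1) = classNumberPExp κL n)
    (κ : ZpExtension ℚ p) (hκ : κ.IsCyclotomic) :
    ∃ (γ : Field.absoluteGaloisGroup ℚ) (D : W.FineSelmerDualData κ γ),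
      Module.Finite ℤ_[p] (RestrictScalars ℤ_[p] (IwasawaAlgebra p) D.X) := by
  haveI : NeZero p := ⟨(Fact.out : p.Prime).ne_zero⟩
  have hL := W.unipotentStabilizerField_le_divisionField p P
  haveI : FiniteDimensional ℚ (W.unipotentStabilizerField p P) := finiteDimensional_of_le_divisionField' W p hL
  haveI : NumberField (W.unipotentStabilizerField p P) := NumberField.mk
  refine hLim W p hp _ hL (W.exists_finrank_divisionField_eq_pow_mul_finrank_unipotentStabilizerField p P)
    ?_ κ hκ
  intro κL hκL
  exact classicalMuVanishes_of_classNumberPExp_succ_eq hF1 κL (hram κL hκL) (Nat.zero_le n) (hord κL hκL)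

/-- **Door (Fukuda 1994 Thm. 1 (2) ∘ Lim 2017 Thm. 3.5) on `L_P = ℚ(E[p])^{U_P}`, by name, at any layer `n`** —
as the previous door with the `p`-RANK certificate `rank_p Cl(L_{P,n+1}) = rank_p Cl(L_{P,n})`.  CONDITIONAL on
the two facts; (A) not asserted.
[cite: Lim2017FineSelmer, §3 Thm. 3.5 and Lemma 3.2 (arXiv:1306.2047 pp. 6–7)] [cite: Fukuda1994, Thm. 1 (2), p. 264] -/
theorem fineSelmerDual_moduleFinite_of_classGroupPRank_succ_eq_unipotentStabilizerField
    (hF2 : fukuda1994_thm1_classGroupPRank_const_of_succ_eq)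
    (hLim : thm35_fineSelmerDual_moduleFinite_of_classicalMuVanishes_of_le_divisionField)
    (W : WeierstrassCurve ℚ) [W.IsElliptic] (p : ℕ) [Fact p.Prime] (hp : p ≠ 2) (n : ℕ) (P : geomTorsion W p)
    (hram : haveI : NeZero p := ⟨(Fact.out : p.Prime).ne_zero⟩
      ∀ κL : ZpExtension (W.unipotentStabilizerField p P) p, κL.IsCyclotomic → TotallyRamifiedFrom κL 0)
    (hrk : haveI : NeZero p := ⟨(Fact.out : p.Prime).ne_zero⟩
      ∀ κL : ZpExtension (W.unipotentStabilizerField p P) p, κL.IsCyclotomic →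
        classGroupPRank κL (n + 1) = classGroupPRank κL n)
    (κ : ZpExtension ℚ p) (hκ : κ.IsCyclotomic) :
    ∃ (γ : Field.absoluteGaloisGroup ℚ) (D : W.FineSelmerDualData κ γ),
      Module.Finite ℤ_[p] (RestrictScalars ℤ_[p] (IwasawaAlgebra p) D.X) := by
  haveI : NeZero p := ⟨(Fact.out : p.Prime).ne_zero⟩
  have hL := W.unipotentStabilizerField_le_divisionField p P
  haveI : FiniteDimensional ℚ (W.unipotentStabilizerField p P) := finiteDimensional_of_le_divisionField' W p hL
  haveI : NumberField (W.unipotentStabilizerField p P) := NumberField.mk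
  refine hLim W p hp _ hL (W.exists_finrank_divisionField_eq_pow_mul_finrank_unipotentStabilizerField p P)
    ?_ κ hκ
  intro κL hκL
  exact classicalMuVanishes_of_classGroupPRank_succ_eq hF2 κL (hram κL hκL) (Nat.zero_le n) (hrk κL hκL)

end Literature.NumberTheory.EllipticCurves.Lim2017

end
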